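import Summits.Langlands.Langlands.Theorems.IrreducibilityBySelfDualityIrreducibleOffSectorTransfer
import Summits.Langlands.Langlands.Theorems.IrreducibilityBySelfDualityIrreducibleGL3CMCyclotomicUntwist
import Summits.Langlands.Langlands.Theorems.IrreducibilityBySelfDualityReducibleForcesEssSelfDual
import Literature.NumberTheory.Automorphic.CuspidalContragredientProofs
import Literature.NumberTheory.GaloisRepresentations.WeakAbelianDirectSummandCyclotomicProofs
import HarnessLib

/-!
# `IrreducibleOffSector` in rank three for ARBITRARY cuspidal `π` that is not essentially
# self-dual: one `E`-rational avatar makes every avatar irreducible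
(crux stmt-Langlands-14329 `IrreducibilityBySelfDuality.IrreducibleOffSector`, line `Sketch`;
`--supports` file, STRUCTURAL: no import of the route module)

The generic rank-three child `isIrreducible_rank_three_of_isRegular_of_not_essSelfDual` (p117318)
uses the regularity and L-algebraicity of `π` at exactly one point — Clozel's Hecke field, to make
the avatars `E`-RATIONAL — exactly as in rank two (`…RankTwoRational`, p117233).  The rest of
Böckle–Hui's §3.2.1 argument (`reducibleForcesEssSelfDual_of`, part (1)) is insensitive to `π_∞`:
a stable line of a reducible semisimple `E`-rational avatar is, by Böckle–Hui's Thm. 1.1 (the text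
of the route item `WeakAbelianSummandHecke`, a theorem of the tree), an algebraic Hecke character `μ`
with `μ(ϖ_v) ∈ t_{π,v}` a.e., and the Jacquet–Shalika pole calculus (`prod_satake_eq_cube_of_JS'`:
`∧² = contragredient ⊗ det`, Arthur–Clozel (2.2) + the proved contragredient datum) gives
`∏ t_{π,v} = μ(ϖ_v)³`, whence `t_{π,v}⁻¹ = μ(ϖ_v)⁻² t_{π,v}`: `π` is essentially self-dual.  Hence:

* `prod_X_sub_C_mul` — rescaling the roots of `∏ (X - rᵢ)` by a unit `c`:
  `∏ (X - c rᵢ) = c^d · (∏ (X - rᵢ))(c⁻¹ X)`;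
* `exists_polynomial_map_eq_arithFrobPolyOfSatake_three_of_one` — `E`-rationality crosses the
  cyclotomic untwist: if `arithFrobPolyOfSatake ι q 1 α` is defined over `E` then so is
  `arithFrobPolyOfSatake ι q 3 α` (its roots are those of the former times `q⁻¹`);
* `exists_essSelfDual_of_not_isIrreducible_of_rational` — Böckle–Hui §3.2.1 part (1) for ANY
  cuspidal `π` on `GL_3(𝔸_K)`, ANY `K`, and an `E`-rational reducible semisimple avatar in the
  C-normalisation;
* `isIrreducible_rank_three_of_not_essSelfDual_of_exists_rational` — for ANY number field `K` and
  ANY cuspidal `π` on `GL_3(𝔸_K)` (no archimedean hypothesis) that is not essentially self-dual at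
  Satake level, if `π` admits ONE avatar `ρ₀` that is Satake–Frobenius compatible and `E`-rational at
  almost all places, then EVERY a.e.-compatible `ρ` is irreducible — modulo the
  `WeakAbelianSummandHecke` text and Arthur–Clozel (2.2) only.

So in rank three, off the essentially self-dual locus, the open content of the crux is again the
arithmetic input "an `E`-rational avatar exists" (automatic for regular `π` by Clozel: p117318).

References: G. Böckle, C.-Y. Hui, Math. Ann. 393 (2025), Thm. 1.1, §3.2.1; H. Jacquet, J. Shalika,
Amer. J. Math. 103 (1981) II, Thm. 4.4; K. Buzzard, T. Gee, LMS LNS 414 (2014), §2.1, Conj. 3.1.6.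
-/

noncomputable section

set_option linter.dupNamespace false

open scoped NumberField Classical Polynomial
open Filter IsDedekindDomain NumberField Polynomial
open Literature.NumberTheory.Automorphic Literature.NumberTheory.GaloisRepresentations
open Summit.Langlands

namespace Summit.Langlands.Langlands.Theorems.IrreducibleOffSector

/-! ### Rescaling the roots of a split polynomial -/

/-- **Rescaling roots by a unit**: `∏_{r ∈ R} (X - c r) = c^{|R|} · (∏_{r ∈ R} (X - r)) ∘ (c⁻¹ X)`
over a field, for `c ≠ 0`. [folklore] -/
theorem prod_X_sub_C_mul {k : Type*} [Field k] (R : Multiset k) {c : k} (hc : c ≠ 0) :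
    (R.map fun r => X - C (c * r)).prod =
      C (c ^ Multiset.card R) * ((R.map fun r => X - C r).prod).comp (C c⁻¹ * X) := by
  induction R using Multiset.induction_on with
  | empty => simp
  | cons r R ih =>
    rw [Multiset.map_cons, Multiset.prod_cons, Multiset.map_cons, Multiset.prod_cons,
      Multiset.card_cons, mul_comp, sub_comp, X_comp, C_comp, ih, pow_succ]
    have h1 : (X - C (c * r) : k[X]) = C c * (C c⁻¹ * X - C r) := by
      rw [mul_sub, ← mul_assoc, ← C_mul, mul_inv_cancel₀ hc, C_1, one_mul, ← C_mul]
    rw [h1, C_mul]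
    ring

/-! ### `E`-rationality across the cyclotomic untwist -/

/-- **`E`-rationality crosses the cyclotomic untwist.**  If `arithFrobPolyOfSatake ι q 1 α`
(roots `ι⁻¹(a⁻¹)`, `a ∈ α`) is the image of a polynomial over the number field `E` under
`e : E →+* ℚ̄_ℓ`, then so is `arithFrobPolyOfSatake ι q 3 α` (roots `q⁻¹ ι⁻¹(a⁻¹)`,
`arithFrobPolyOfSatake_three`): take `q^{-|α|} P(q X)`. [cite: BuzzardGeeLMS2014, §2.1] -/
theorem exists_polynomial_map_eq_arithFrobPolyOfSatake_three_of_one {ℓ : ℕ} [Fact ℓ.Prime]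
    (ι : PadicAlgCl ℓ ≃+* ℂ) {E : Type} [Field E] [NumberField E] (e : E →+* PadicAlgCl ℓ)
    {q : ℕ} (hq : 0 < q) {α : Multiset ℂ} {P : Polynomial E}
    (hP : P.map e = arithFrobPolyOfSatake ι q 1 α) :
    ∃ P₃ : Polynomial E, P₃.map e = arithFrobPolyOfSatake ι q 3 α := by
  have hqE : (q : E) ≠ 0 := by exact_mod_cast hq.ne'
  have hqA : (q : PadicAlgCl ℓ) ≠ 0 := by exact_mod_cast hq.ne'
  refine ⟨C ((q : E)⁻¹ ^ Multiset.card α) * P.comp (C (q : E) * X), ?_⟩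
  rw [Polynomial.map_mul, map_C, map_pow, map_inv₀, map_natCast, Polynomial.map_comp,
    Polynomial.map_mul, map_C, map_natCast, map_X, hP, IrreducibleGL3CM.arithFrobPolyOfSatake_three,
    prod_X_sub_C_mul _ (inv_ne_zero hqA), inv_inv, Multiset.card_map, arithFrobPolyOfSatake_one,
    Multiset.map_map]
  rfl

/-! ### Böckle–Hui §3.2.1, part (1), for an `E`-rational avatar of an arbitrary cuspidal `π` -/

section EssSelfDual

variable {K : Type} [Field K] [NumberField K] {hcpt : isCompact_glFiniteIntegralLevel 3 K}
  {ℓ : ℕ} [Fact ℓ.Prime]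

/-- `(χ₁ χ₂)(ϖ_v) = χ₁(ϖ_v) χ₂(ϖ_v)`. [folklore] -/
private theorem vAU_mul (χ₁ χ₂ : HeckeCharacter K) (v : HeightOneSpectrum (𝓞 K)) :
    (χ₁ * χ₂).valueAtUniformizer v = χ₁.valueAtUniformizer v * χ₂.valueAtUniformizer v := by
  simp only [HeckeCharacter.valueAtUniformizer, HeckeCharacter.localComponent_apply,
    HeckeCharacter.mul_apply, Units.val_mul]

/-- `χ⁻¹(ϖ_v) = χ(ϖ_v)⁻¹`. [folklore] -/
private theorem vAU_inv (χ : HeckeCharacter K) (v : HeightOneSpectrum (𝓞 K)) :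
    χ⁻¹.valueAtUniformizer v = (χ.valueAtUniformizer v)⁻¹ := by
  simp only [HeckeCharacter.valueAtUniformizer, HeckeCharacter.localComponent_apply,
    HeckeCharacter.inv_apply, Units.val_inv_eq_inv_val]

/-- `χ(ϖ_v) ≠ 0`. [folklore] -/
private theorem vAU_ne_zero (χ : HeckeCharacter K) (v : HeightOneSpectrum (𝓞 K)) :
    χ.valueAtUniformizer v ≠ 0 := by
  simp only [HeckeCharacter.valueAtUniformizer, HeckeCharacter.localComponent_apply]
  exact Units.ne_zero _

/-- **A reducible `E`-rational avatar makes `π` essentially self-dual** (Böckle–Hui 2025 §3.2.1,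
part (1), for an ARBITRARY cuspidal `π` on `GL_3(𝔸_K)` over any number field `K`).  Grant
Böckle–Hui's Thm. 1.1 in cofinite `GL(1)` form (the text of the route item `WeakAbelianSummandHecke`)
and Arthur–Clozel (2.2).  Let `r : Γ_K → GL_3(ℚ̄_ℓ)` be semisimple, compatible with `(π, ι)` at almost
all places in the C-normalisation `arithFrobPolyOfSatake ι q_v 3 α`, `E`-rational at almost all
places (`E` a number field, `e : E →+* ℚ̄_ℓ`), and NOT irreducible.  Then `π` is essentially self-dual
at Satake level: there is a cuspidal `GL(1)` datum `η` with `t_{π,v}⁻¹ = η(ϖ_v) · t_{π,v}` for almost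
all `v`.  Proof: a stable line of `r` (`exists_stableLine_of_not_isIrreducible`) has a character that
weakly divides `r`, hence (Thm. 1.1) is attached to a cuspidal `GL(1)` datum, giving a Hecke character
`μ` with `μ(ϖ_v) ∈ t_{π,v}` a.e. (`exists_heckeCharacter_mem_satake_of_glOne`); the pole calculus
`prod_satake_eq_cube_of_JS'` gives `∏ t_{π,v} = μ(ϖ_v)³`, so `t_{π,v}⁻¹ = μ(ϖ_v)⁻² t_{π,v}`
(`map_inv_eq_map_mul_of_prod_eq_cube`), and `η` is the `GL(1)` datum of `μ⁻²`.
[cite: BockleHui2025, Theorem 1.1 and §3.2.1] [cite: JacquetShalikaAJM1981II, Thm. 4.4] -/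
theorem exists_essSelfDual_of_not_isIrreducible_of_rational
    (hWA : ∀ (K : Type) [Field K] [NumberField K] (h1 : isCompact_glFiniteIntegralLevel 1 K) (ℓ : ℕ) [Fact ℓ.Prime] (n : ℕ) (E : Type) [Field E] [NumberField E] (e : E →+* PadicAlgCl ℓ) (ρ : Literature.NumberTheory.GaloisRepresentations.FramedGaloisRep K (PadicAlgCl ℓ) n), ρ.toGaloisRep.IsSemisimple → (∀ᶠ v in cofinite, ρ.IsUnramifiedAt v ∧ ∃ P : Polynomial E, ρ.HasFrobCharpolyAt v (P.map e)) → ∀ (ψ : Literature.NumberTheory.GaloisRepresentations.FramedGaloisRep K (PadicAlgCl ℓ) 1), (∀ᶠ v in cofinite, ρ.IsUnramifiedAt v ∧ ψ.IsUnramifiedAt v ∧ ∀ 𝔓 ∈ v.primesAbove, ∀ σ : Field.absoluteGaloisGroup K, IsArithFrobAt (NumberField.RingOfIntegers K) σ 𝔓 → ψ.charpoly σ ∣ ρ.charpoly σ) → ∀ (ι : PadicAlgCl ℓ ≃+* ℂ), ∃ χ : Literature.NumberTheory.Automorphic.CuspidalAutomorphicRepData 1 K h1, χ.1.IsRegularAlgebraic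 ∧ ∀ᶠ v in cofinite, ∃ c : ℂ, χ.1.HasSatakeParamAt v {c} ∧ ψ.IsUnramifiedAt v ∧ ψ.HasFrobCharpolyAt v (Literature.NumberTheory.Automorphic.arithFrobPolyOfSatake ι v.residueCard 1 {c}))
    (h22 : JacquetShalika1981_partialPairL_boundary_repData)
    (h1 : isCompact_glFiniteIntegralLevel 1 K) (π : CuspidalAutomorphicRepData 3 K hcpt)
    (ι : PadicAlgCl ℓ ≃+* ℂ) {E : Type} [Field E] [NumberField E] (e : E →+* PadicAlgCl ℓ)
    (r : FramedGaloisRep K (PadicAlgCl ℓ) 3) (hss : r.toGaloisRep.IsSemisimple)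
    (hr : ∀ᶠ v : HeightOneSpectrum (𝓞 K) in cofinite, ∀ α : Multiset ℂ, π.1.HasSatakeParamAt v α →
      r.IsUnramifiedAt v ∧ r.HasFrobCharpolyAt v (arithFrobPolyOfSatake ι v.residueCard 3 α))
    (hrat : ∀ᶠ v : HeightOneSpectrum (𝓞 K) in cofinite,
      r.IsUnramifiedAt v ∧ ∃ P : Polynomial E, r.HasFrobCharpolyAt v (P.map e))
    (hirr : ¬ r.toGaloisRep.IsIrreducible) :
    ∃ η : CuspidalAutomorphicRepData 1 K h1, ∀ᶠ v : HeightOneSpectrum (𝓞 K) in cofinite,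
      ∀ α : Multiset ℂ, π.1.HasSatakeParamAt v α →
        ∃ c : ℂ, η.1.HasSatakeParamAt v {c} ∧ α.map (fun a => a⁻¹) = α.map (fun a => c * a) := by
  have hCon : CuspidalAutomorphicRepData.exists_contragredient_satake hcpt :=
    CuspidalAutomorphicRepData.exists_contragredient_satake_holds hcpt
  -- a stable line, its character `τ`, and Böckle–Hui's GL(1) datum `χ`
  obtain ⟨τ, x, hx0, hx⟩ := FramedGaloisRep.exists_stableLine_of_not_isIrreducible r hss hirr
  obtain ⟨χ, -, hχ⟩ := hWA K h1 ℓ 3 E e r hss hrat τ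
    (ReducibleForcesEssSelfDual.eventually_weaklyDivides_of_stableLine π.1 ι r hr hx0 hx) ι
  -- the Hecke character `μ` with `μ(ϖ_v) ∈ t_{π,v}` a.e., and the pole calculus
  obtain ⟨μ, hμ⟩ :=
    ReducibleForcesEssSelfDual.exists_heckeCharacter_mem_satake_of_glOne π.1 ι r hr hx0 hx χ hχ
  have hcube := prod_satake_eq_cube_of_JS' h22 hCon π hμ
  obtain ⟨η, hη⟩ := exists_cuspidal_glOne_hasSatakeParamAt_valueAtUniformizer h1 (μ * μ)⁻¹
  refine ⟨η, ?_⟩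
  filter_upwards [hμ, hcube, hη] with v hμv hcv hηv α hα
  refine ⟨_, hηv, ?_⟩
  rw [vAU_inv, vAU_mul, ← pow_two]
  exact map_inv_eq_map_mul_of_prod_eq_cube hα.card_eq (vAU_ne_zero μ v) (hμv α hα) (hcv α hα)

end EssSelfDual

/-! ### The child: one `E`-rational avatar off the essentially self-dual locus -/

/-- **`IrreducibleOffSector` in rank three, ANY cuspidal `π` that is not essentially self-dual, from
ONE `E`-rational avatar.**  Grant Böckle–Hui 2025 Thm. 1.1 in cofinite `GL(1)` form (the text of the
route item `WeakAbelianSummandHecke`, a theorem of the tree) and Arthur–Clozel (2.2) for Borel–Jacquet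
data.  Let `K` be ANY number field and `π` ANY cuspidal datum on `GL_3(𝔸_K)` (no archimedean
hypothesis) which is not essentially self-dual at Satake level (no cuspidal `GL(1)` datum `η` with
`t_{π,v}⁻¹ = η(ϖ_v) · t_{π,v}` a.e.).  If `π` admits ONE `ρ₀ : Γ_K → GL_3(ℚ̄_ℓ)` that is
Satake–Frobenius compatible with `(π, ι)` and `E`-rational at almost all places (`E` a number field),
then EVERY `ρ` Satake–Frobenius compatible with `(π, ι)` at almost all places is irreducible.  Proof:
`ρ₀` is irreducible — otherwise its cyclotomic untwist (compatible in the C-normalisation, still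
`E`-rational: `exists_polynomial_map_eq_arithFrobPolyOfSatake_three_of_one`) and a continuous
semisimplification of it would be a reducible `E`-rational avatar, making `π` essentially self-dual
(`exists_essSelfDual_of_not_isIrreducible_of_rational`) — and irreducibility transfers to `ρ`
(Chebotarev + Brauer–Nesbitt, `isIrreducible_of_satakeFrobCompatible`, p79199).
[cite: BockleHui2025, Theorem 1.1 and §3.2.1] [cite: DeligneSerreASENS1974, Lemme 3.2] -/
theorem isIrreducible_rank_three_of_not_essSelfDual_of_exists_rational
    (hWA : ∀ (K : Type) [Field K] [NumberField K] (h1 : isCompact_glFiniteIntegralLevel 1 K) (ℓ : ℕ) [Fact ℓ.Prime] (n : ℕ) (E : Type) [Field E] [NumberField E] (e : E →+* PadicAlgCl ℓ) (ρ : Literature.NumberTheory.GaloisRepresentations.FramedGaloisRep K (PadicAlgCl ℓ) n), ρ.toGaloisRep.IsSemisimple → (∀ᶠ v in cofinite, ρ.IsUnramifiedAt v ∧ ∃ P : Polynomial E, ρ.HasFrobCharpolyAt v (P.map e)) → ∀ (ψ : Literature.NumberTheory.GaloisRepresentations.FramedGaloisRep K (PadicAlgCl ℓ) 1), (∀ᶠ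 v in cofinite, ρ.IsUnramifiedAt v ∧ ψ.IsUnramifiedAt v ∧ ∀ 𝔓 ∈ v.primesAbove, ∀ σ : Field.absoluteGaloisGroup K, IsArithFrobAt (NumberField.RingOfIntegers K) σ 𝔓 → ψ.charpoly σ ∣ ρ.charpoly σ) → ∀ (ι : PadicAlgCl ℓ ≃+* ℂ), ∃ χ : Literature.NumberTheory.Automorphic.CuspidalAutomorphicRepData 1 K h1, χ.1.IsRegularAlgebraic ∧ ∀ᶠ v in cofinite, ∃ c : ℂ, χ.1.HasSatakeParamAt v {c} ∧ ψ.IsUnramifiedAt v ∧ ψ.HasFrobCharpolyAt v (Literature.NumberTheory.Automorphic.arithFrobPolyOfSatake ι v.residueCard 1 {c}))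
    (h22 : JacquetShalika1981_partialPairL_boundary_repData)
    {K : Type} [Field K] [NumberField K] (h1 : isCompact_glFiniteIntegralLevel 1 K)
    {hcpt : isCompact_glFiniteIntegralLevel 3 K} (π : CuspidalAutomorphicRepData 3 K hcpt)
    (hnsd : ∀ η : CuspidalAutomorphicRepData 1 K h1,
      ¬ ∀ᶠ v : HeightOneSpectrum (𝓞 K) in cofinite, ∀ α : Multiset ℂ, π.1.HasSatakeParamAt v α →
        ∃ c : ℂ, η.1.HasSatakeParamAt v {c} ∧ α.map (fun a => a⁻¹) = α.map (fun a => c * a))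
    {ℓ : ℕ} [Fact ℓ.Prime] (ι : PadicAlgCl ℓ ≃+* ℂ) {E : Type} [Field E] [NumberField E]
    (e : E →+* PadicAlgCl ℓ) {ρ₀ : FramedGaloisRep K (PadicAlgCl ℓ) 3}
    (hρ₀ : ∀ᶠ v : HeightOneSpectrum (𝓞 K) in cofinite, SatakeFrobCompatibleAt ι π.1 ρ₀ v)
    (hrat₀ : ∀ᶠ v : HeightOneSpectrum (𝓞 K) in cofinite,
      ρ₀.IsUnramifiedAt v ∧ ∃ P : Polynomial E, ρ₀.HasFrobCharpolyAt v (P.map e))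
    (ρ : FramedGaloisRep K (PadicAlgCl ℓ) 3)
    (hρ : ∀ᶠ v : HeightOneSpectrum (𝓞 K) in cofinite, SatakeFrobCompatibleAt ι π.1 ρ v) :
    ρ.toGaloisRep.IsIrreducible := by
  refine isIrreducible_of_satakeFrobCompatible π.1 ι ?_ hρ₀ hρ
  -- the cyclotomic untwist `ρ₀'` of `ρ₀`: compatible a.e. in the C-normalisation, and `E`-rational
  obtain ⟨ρ₀', himp, hρ₀'v⟩ := IrreducibleGL3CM.stub_cyclotomicUntwist K ℓ ι ρ₀
  refine himp ?_
  have hc : ∀ᶠ v : HeightOneSpectrum (𝓞 K) in cofinite,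
      (∀ α : Multiset ℂ, π.1.HasSatakeParamAt v α →
        ρ₀'.IsUnramifiedAt v ∧ ρ₀'.HasFrobCharpolyAt v (arithFrobPolyOfSatake ι v.residueCard 3 α)) ∧
      (ρ₀'.IsUnramifiedAt v ∧ ∃ P : Polynomial E, ρ₀'.HasFrobCharpolyAt v (P.map e)) := by
    filter_upwards [hρ₀, hrat₀, FramedGaloisRep.eventually_natCast_not_mem K ℓ] with v hv hratv hℓ
    obtain ⟨α₀, hα₀, hur, hcp⟩ := hv
    obtain ⟨hur', hcp'⟩ := hρ₀'v v hℓ hur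
    refine ⟨fun α hα => ?_, hur', ?_⟩
    · obtain rfl : α = α₀ := AutomorphicRepData.hasSatakeParamAt_unique_holds π.1 hα hα₀
      exact ⟨hur', hcp' α hcp⟩
    · obtain ⟨-, P, hP⟩ := hratv
      -- `P.map e` IS the Satake-shaped polynomial of `ρ₀` at `v` (uniqueness of Frobenius polynomials)
      have heq : P.map e = arithFrobPolyOfSatake ι v.residueCard 1 α₀ :=
        GaloisRep.HasFrobCharpolyAt.unique_holds
          ((FramedGaloisRep.hasFrobCharpolyAt_toGaloisRep_iff v _ ρ₀).mpr hP)
          ((FramedGaloisRep.hasFrobCharpolyAt_toGaloisRep_iff v _ ρ₀).mpr hcp)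
      obtain ⟨P₃, hP₃⟩ := exists_polynomial_map_eq_arithFrobPolyOfSatake_three_of_one ι e
        (lt_trans zero_lt_one v.one_lt_residueCard) heq
      exact ⟨P₃, hP₃ ▸ hcp' α₀ hcp⟩
  -- a continuous semisimplification `r` of `ρ₀'`: compatible, `E`-rational, semisimple
  obtain ⟨r, hrss, hrcp, hrker⟩ := IrreducibleGL3CM.stub_continuousSemisimplification K ℓ 3 ρ₀'
  have hr : ∀ᶠ v : HeightOneSpectrum (𝓞 K) in cofinite, ∀ α : Multiset ℂ, π.1.HasSatakeParamAt v α →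
      r.IsUnramifiedAt v ∧ r.HasFrobCharpolyAt v (arithFrobPolyOfSatake ι v.residueCard 3 α) := by
    filter_upwards [hc] with v hv α hα
    obtain ⟨hur, hcp⟩ := hv.1 α hα
    exact ⟨fun 𝔓 h𝔓 σ hσ => hrker σ (hur 𝔓 h𝔓 σ hσ),
      fun 𝔓 h𝔓 σ hσ => (hrcp σ).trans (hcp 𝔓 h𝔓 σ hσ)⟩
  have hrrat : ∀ᶠ v : HeightOneSpectrum (𝓞 K) in cofinite,
      r.IsUnramifiedAt v ∧ ∃ P : Polynomial E, r.HasFrobCharpolyAt v (P.map e) := by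
    filter_upwards [hc] with v hv
    obtain ⟨hur, P, hP⟩ := hv.2
    exact ⟨fun 𝔓 h𝔓 σ hσ => hrker σ (hur 𝔓 h𝔓 σ hσ), P,
      fun 𝔓 h𝔓 σ hσ => (hrcp σ).trans (hP 𝔓 h𝔓 σ hσ)⟩
  -- a reducible avatar would make `π` essentially self-dual
  by_contra hirr
  have hrirr : ¬ r.toGaloisRep.IsIrreducible :=
    IrreducibleGL3CM.stub_not_isIrreducible_of_charpoly_eq K ℓ 3 ρ₀' r hrss hrcp hirr
  obtain ⟨η, hη⟩ := exists_essSelfDual_of_not_isIrreducible_of_rational hWA h22 h1 π ι e r hrss hr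
    hrrat hrirr
  exact hnsd η hη

end Summit.Langlands.Langlands.Theorems.IrreducibleOffSector

end
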